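import Mathlib
import HarnessLib
import Summits.NavierStokesRegularity.NavierStokesRegularity.Theorems.TaylorModelRungThreeCertificateFormatVRadiiSound

/-!
# Crux K1b-DR (stmt-NavierStokesRegularity-23954), line `taylor-model` — v3 certificate SOUNDNESS, core side part 1: the
# STAGE / NODE clauses of `ChainVCore` (the a-block) and the sub-step bookkeeping clauses for the interpreted records
# `toCertDataVW / toBoxesW` (successor engine-1 g67; `TaylorModelV.ChainVCore` p620175 ll. 96–114)

For `cd := TV.toCertDataVW kitOf wT sc`, `bx := TV.toBoxesW kitOf wT`, from the Booleans (`ChecksOK` of `…FormatVRadiiSound` +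
`CoreChecksOK`: `1 ≤ S`, `0 < h`, `wT ≥ 0`):

* `1 ≤ S j`, `Tn j 0 = 0`, `0 < h j s`, `Tn j (s+1) = Tn j s + h j s`;
* the a-block at every node `s ≤ S j`: window support of `x` and of the jets `P` (`wsupp_taylorJet`: `Qb` is window-supported),
  linearity / support of the frames, the EXACT frame clause `Ci (Cm v) = v`, `Cm (Ci v) = v` on window-supported `v`
  (`invMat` under the Neumann node test), `P 0 = x` and the jet recursion (`taylorJet_succ` — true for every `n`), `Wv 0 = trunc`,
  the variational recursion below `pdegV` (`varJet_succ`) and `Wv = 0` above, `rPl ≥ 0` (node test), the trivial nesting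
  `rPl 0 ≤ rPl 1 ≤ rPl 2`, the hull clauses `NodeStart l z → z ∈ [hlo l, hhi l]` and the hull nesting (radii monotone:
  `|B|rp ≤ |Vc|rB + e + |B|rp ≤ … + wT`);
* and, for the read-outs side, the TUBE-HULL fact (R1, vector form): `y ∈ H¹`, `|d| ≤ wT` ⇒ `y + d ∈ H²`.

The six sub-step conjuncts (E)/(J)/(D1κ)/(V1)/(JU)/(M) come from typer g32's `coreStep_sound` family and are assembled in the
next file. MODEL-lattice bookkeeping only (rung TL-M3); nothing here is a statement about the Navier–Stokes equations.
-/

-- the sub-problem namespace repeats the summit name by design (D-0017)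
set_option linter.dupNamespace false

namespace Summit.NavierStokesRegularity.NavierStokesRegularity.Theorems.TaylorModelCert

open scoped BigOperators
open Literature.Analysis.FluidPDE.TaoCascade Literature.Analysis.FluidPDE.TaoCascade.TaylorChain
open Summit.NavierStokesRegularity.NavierStokesRegularity.Theorems.TaylorModelReadout
open Summit.NavierStokesRegularity.NavierStokesRegularity.Theorems.TaylorModelV

/-! ### Generic facts -/

section Generic

/-- Taylor jets of the truncated bilinear field are window-supported (order `0`: the base point). [folklore] -/
theorem wsupp_taylorJet (d : CertData) {x : Fin 4 → ℤ → ℝ} (hx : d.Wsupp x) : ∀ n, d.Wsupp (taylorJet d.Qb x n)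
  | 0 => by rw [taylorJet_zero]; exact hx
  | n + 1 => by
    have hk : ((n : ℝ) + 1) ≠ 0 := by positivity
    have e : taylorJet d.Qb x (n + 1) =
        ((n : ℝ) + 1)⁻¹ • ∑ m ∈ Finset.range (n + 1), d.Qb (taylorJet d.Qb x m) (taylorJet d.Qb x (n - m)) := by
      rw [← taylorJet_succ d.Qb x n, smul_smul, inv_mul_cancel₀ hk, one_smul]
    intro i k hik
    rw [e, Pi.smul_apply, Pi.smul_apply, Finset.sum_apply, Finset.sum_apply, smul_eq_mul]
    rw [Finset.sum_eq_zero fun m _ => wsupp_Qb d _ _ i k hik, mul_zero]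

/-- An upward product of nonnegative data is nonnegative. [folklore] -/
theorem absMulVecUp_nonneg {n : ℕ} (prec : ℕ) {A : Array (Array Dyad)} {R : Array Dyad}
    (hA : ∀ r < n, ∀ c < n, 0 ≤ dre A r c) (hR : ∀ c < n, 0 ≤ vre R c) {r : ℕ} (hr : r < n) :
    0 ≤ vre (absMulVecUp n prec A R) r :=
  le_trans (Finset.sum_nonneg fun t ht => mul_nonneg (hA r hr t (Finset.mem_range.1 ht)) (hR t (Finset.mem_range.1 ht)))
    (sum_le_absMulVecUp prec (x := fun r t => dre A r t * vre R t) (fun _ _ _ _ => le_rfl) hr)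

/-- `addVecUp u v ≥ u` when `v ≥ 0`. [folklore] -/
theorem le_addVecUp_left {n : ℕ} (prec : ℕ) (u : Array Dyad) {v : Array Dyad} (hv : ∀ c < n, 0 ≤ vre v c) {c : ℕ}
    (hc : c < n) : vre u c ≤ vre (addVecUp n prec u v) c :=
  le_trans (le_add_of_nonneg_right (hv c hc)) (add_le_addVecUp prec u v hc)

/-- `addVecUp u v ≥ v` when `u ≥ 0`. [folklore] -/
theorem le_addVecUp_right {n : ℕ} (prec : ℕ) {u : Array Dyad} (v : Array Dyad) (hu : ∀ c < n, 0 ≤ vre u c) {c : ℕ}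
    (hc : c < n) : vre v c ≤ vre (addVecUp n prec u v) c :=
  le_trans (le_add_of_nonneg_left (hu c hc)) (add_le_addVecUp prec u v hc)

end Generic

namespace CertTablesV

variable (TV : CertTablesV) (kitOf : ℕ → CoreKit) (wT : ℕ → Array Dyad) (sc : ScalarsV)

/-- The extra Booleans the core-side node clauses consume. [folklore] -/
structure CoreChecksOK : Prop where
  /-- at least one sub-step per stage -/
  S_pos : ∀ j, j ≤ TV.base.N₀ → 1 ≤ TV.S j
  /-- positive step sizes -/
  h_pos : ∀ j, j ≤ TV.base.N₀ → ∀ s, s < TV.S j → Dyad.blt Dyad.zero (TV.hD j s) = true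
  /-- nonnegative tube inflation -/
  wT_nonneg : ∀ j, j ≤ TV.base.N₀ → nonnegVec TV.base.n (wT j) = true

variable {TV kitOf wT sc}

/-! ### Radii monotonicity: `radL 0 ≤ radL 1 ≤ radL 2` -/

section Radii

/-- `rp ≥ 0` at every node. [folklore] -/
theorem rp_nonneg (hC : ChecksOK TV kitOf wT) {j : ℕ} (hj : j ≤ TV.base.N₀) {s : ℕ} (hs : s ≤ TV.S j) {c : ℕ}
    (hc : c < TV.base.n) : 0 ≤ vre (TV.nodeVW kitOf wT j s).rp c :=
  (exists_inv_of_nodeOK TV.prec (nodeOK_nodeV hC hj hs)).2.2 c hc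

/-- `e ≥ 0` at every node. [folklore] -/
theorem e_nonneg (hC : ChecksOK TV kitOf wT) {j : ℕ} (hj : j ≤ TV.base.N₀) {s : ℕ} (hs : s ≤ TV.S j) {c : ℕ}
    (hc : c < TV.base.n) : 0 ≤ vre (TV.nodeVW kitOf wT j s).e c :=
  (exists_inv_of_nodeOK TV.prec (nodeOK_nodeV hC hj hs)).2.1 c hc

/-- `radL 0 ≤ radL 1`. [folklore] -/
theorem radL0_le_radL1 (hC : ChecksOK TV kitOf wT) {j : ℕ} (hj : j ≤ TV.base.N₀) {s : ℕ} (hs : s ≤ TV.S j) {c : ℕ}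
    (hc : c < TV.base.n) :
    vre (TV.radLW kitOf wT j 0 (TV.nodeVW kitOf wT j s)) c ≤ vre (TV.radLW kitOf wT j 1 (TV.nodeVW kitOf wT j s)) c := by
  show vre (absMulVecUp TV.base.n TV.prec (absD TV.base.n (TV.nodeVW kitOf wT j s).B) (TV.nodeVW kitOf wT j s).rp) c ≤
    vre ((TV.ctxOfW kitOf wT j).hullRad (TV.nodeVW kitOf wT j s)) c
  unfold StageCtx.hullRad
  refine le_addVecUp_right TV.prec _ (fun c' hc' => ?_) hc
  have hA : ∀ r < TV.base.n, ∀ c < TV.base.n, 0 ≤ dre (absD TV.base.n (TV.nodeVW kitOf wT j s).Vc) r c :=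
    fun r hr c hc => by rw [dre_absD _ hr hc]; exact abs_nonneg _
  exact le_trans (absMulVecUp_nonneg TV.prec hA (fun c hc => nonneg_of_nonnegVec (hC.rB j hj) hc) hc')
    (le_addVecUp_left TV.prec _ (fun c hc => e_nonneg hC hj hs hc) hc')

/-- `radL 1 ≤ radL 2` (needs `wT ≥ 0`). [folklore] -/
theorem radL1_le_radL2 (hK : CoreChecksOK TV wT) {j : ℕ} (hj : j ≤ TV.base.N₀) (s : ℕ) {c : ℕ} (hc : c < TV.base.n) :
    vre (TV.radLW kitOf wT j 1 (TV.nodeVW kitOf wT j s)) c ≤ vre (TV.radLW kitOf wT j 2 (TV.nodeVW kitOf wT j s)) c := by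
  show vre ((TV.ctxOfW kitOf wT j).hullRad (TV.nodeVW kitOf wT j s)) c ≤
    vre (addVecUp TV.base.n TV.prec ((TV.ctxOfW kitOf wT j).hullRad (TV.nodeVW kitOf wT j s)) (wT j)) c
  exact le_addVecUp_left TV.prec _ (fun c hc => nonneg_of_nonnegVec (hK.wT_nonneg j hj) hc) hc

/-- `radL 0 ≥ 0`. [folklore] -/
theorem radL0_nonneg (hC : ChecksOK TV kitOf wT) {j : ℕ} (hj : j ≤ TV.base.N₀) {s : ℕ} (hs : s ≤ TV.S j) {c : ℕ}
    (hc : c < TV.base.n) : 0 ≤ vre (TV.radLW kitOf wT j 0 (TV.nodeVW kitOf wT j s)) c :=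
  absMulVecUp_nonneg TV.prec (fun r hr c hc => by rw [dre_absD _ hr hc]; exact abs_nonneg _)
    (fun c hc => rp_nonneg hC hj hs hc) hc

/-- Monotonicity of the three hull radii in the level (as a function on `Fin 3`). [folklore] -/
theorem radL_mono (hC : ChecksOK TV kitOf wT) (hK : CoreChecksOK TV wT) {j : ℕ} (hj : j ≤ TV.base.N₀) {s : ℕ}
    (hs : s ≤ TV.S j) {c : ℕ} (hc : c < TV.base.n) (l : Fin 3) :
    vre (TV.radLW kitOf wT j 0 (TV.nodeVW kitOf wT j s)) c ≤ vre (TV.radLW kitOf wT j l (TV.nodeVW kitOf wT j s)) c ∧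
      vre (TV.radLW kitOf wT j l (TV.nodeVW kitOf wT j s)) c ≤ vre (TV.radLW kitOf wT j 2 (TV.nodeVW kitOf wT j s)) c := by
  have h01 := radL0_le_radL1 hC hj hs hc
  have h12 := radL1_le_radL2 (kitOf := kitOf) hK hj s hc
  fin_cases l
  · exact ⟨le_rfl, h01.trans h12⟩
  · exact ⟨h01, h12⟩
  · exact ⟨h01.trans h12, le_rfl⟩

end Radii

/-! ### The node clauses -/

section Node

/-- The hull boxes of `toBoxesW`, unfolded. [folklore] -/
theorem bx_hlo (l : Fin 3) (j s : ℕ) : (TV.toBoxesW kitOf wT).hlo l j s =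
    TV.base.vecF (loOf (TV.xD j s) (TV.radLW kitOf wT j l (TV.nodeVW kitOf wT j s))) := rfl

/-- See `bx_hlo`. [folklore] -/
theorem bx_hhi (l : Fin 3) (j s : ℕ) : (TV.toBoxesW kitOf wT).hhi l j s =
    TV.base.vecF (hiOf (TV.xD j s) (TV.radLW kitOf wT j l (TV.nodeVW kitOf wT j s))) := rfl

/-- A `NodeStart` point (any level — all three radii vectors are `rp`) lies within `|B|·rp` of the centre, coordinatewise.
[folklore] -/
theorem abs_sub_le_of_nodeStart {j s : ℕ} {l : Fin 3} {z : Fin 4 → ℤ → ℝ}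
    (hz : NodeStart (TV.toCertDataVW kitOf wT sc) (TV.toBoxesW kitOf wT) j s l z) {c : ℕ} (hc : c < TV.base.n) :
    |TV.base.wv z c - vre (TV.xD j s) c| ≤ vre (TV.radLW kitOf wT j 0 (TV.nodeVW kitOf wT j s)) c := by
  obtain ⟨ξ, hξ, hz⟩ := hz
  have hξ' := TV.base.absLeVec_of_absLeW cd_Kb cd_Ka hξ
  rw [hz]
  show |TV.base.wv (TV.xR j s + TV.base.linF (dre (TV.nodeVW kitOf wT j s).B) ξ) c - vre (TV.xD j s) c| ≤
    vre (absMulVecUp TV.base.n TV.prec (absD TV.base.n (TV.nodeVW kitOf wT j s).B) (TV.nodeVW kitOf wT j s).rp) c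
  have e : TV.base.wv (TV.xR j s + TV.base.linF (dre (TV.nodeVW kitOf wT j s).B) ξ) c - vre (TV.xD j s) c =
      TV.base.wv (TV.base.linF (dre (TV.nodeVW kitOf wT j s).B) ξ) c := by
    rw [← TV.wv_xR j s hc]; simp only [CertTables.wv, Pi.add_apply]; ring
  rw [e, TV.base.wv_linF _ _ hc]
  exact abs_sum_le_absMulVecUp TV.prec (absLeMat_absD _) hξ' hc

/-- Hull clause: `NodeStart l z → z ∈ [hlo l, hhi l]`. [folklore] -/
theorem inBox_of_nodeStart (hC : ChecksOK TV kitOf wT) (hK : CoreChecksOK TV wT) {j : ℕ} (hj : j ≤ TV.base.N₀)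
    {s : ℕ} (hs : s ≤ TV.S j) (l : Fin 3) {z : Fin 4 → ℤ → ℝ}
    (hz : NodeStart (TV.toCertDataVW kitOf wT sc) (TV.toBoxesW kitOf wT) j s l z) :
    InBox (TV.toCertDataVW kitOf wT sc) ((TV.toBoxesW kitOf wT).hlo l j s) ((TV.toBoxesW kitOf wT).hhi l j s) z := by
  rw [bx_hlo, bx_hhi, TV.base.inBox_vecF_iff cd_Kb cd_Ka]
  intro c hc
  have h := abs_le.1 ((abs_sub_le_of_nodeStart hz hc).trans (radL_mono hC hK hj hs hc l).1)
  exact ⟨by unfold loOf; linarith [h.1], by unfold hiOf; linarith [h.2]⟩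

/-- Hull nesting: `hlo 2 ≤ hlo l`, `hhi l ≤ hhi 2`. [folklore] -/
theorem hull_nesting (hC : ChecksOK TV kitOf wT) (hK : CoreChecksOK TV wT) {j : ℕ} (hj : j ≤ TV.base.N₀)
    {s : ℕ} (hs : s ≤ TV.S j) (l : Fin 3) (i : Fin 4) (k : ℤ) :
    (TV.toBoxesW kitOf wT).hlo 2 j s i k ≤ (TV.toBoxesW kitOf wT).hlo l j s i k ∧
      (TV.toBoxesW kitOf wT).hhi l j s i k ≤ (TV.toBoxesW kitOf wT).hhi 2 j s i k := by
  rw [bx_hlo, bx_hhi, bx_hlo, bx_hhi]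
  simp only [CertTables.vecF_apply]
  split_ifs with hk
  · have h := (radL_mono hC hK hj hs (TV.base.idx_lt_n i hk) l).2
    exact ⟨by unfold loOf; linarith, by unfold hiOf; linarith⟩
  · exact ⟨le_rfl, le_rfl⟩

/-- (R1, vector form) the level-1 hull inflated by `wT` lies in the outer hull. [folklore] -/
theorem inBox_hull2_of_hull1_add (j s : ℕ) {y d : Fin 4 → ℤ → ℝ}
    (hy : InBox (TV.toCertDataVW kitOf wT sc) ((TV.toBoxesW kitOf wT).hlo 1 j s) ((TV.toBoxesW kitOf wT).hhi 1 j s) y)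
    (hd : AbsLeW (TV.toCertDataVW kitOf wT sc) d (TV.base.vecF (vre (wT j)))) :
    InBox (TV.toCertDataVW kitOf wT sc) ((TV.toBoxesW kitOf wT).hlo 2 j s) ((TV.toBoxesW kitOf wT).hhi 2 j s) (y + d) := by
  rw [bx_hlo, bx_hhi, TV.base.inBox_vecF_iff cd_Kb cd_Ka] at hy ⊢
  have hd' := TV.base.absLeVec_of_absLeW cd_Kb cd_Ka hd
  intro c hc
  obtain ⟨h1, h2⟩ := hy c hc
  have h3 := abs_le.1 (hd' c hc)
  have hadd := add_le_addVecUp TV.prec ((TV.ctxOfW kitOf wT j).hullRad (TV.nodeVW kitOf wT j s)) (wT j) hc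
  have ewv : TV.base.wv (y + d) c = TV.base.wv y c + TV.base.wv d c := rfl
  unfold loOf at h1
  unfold hiOf at h2
  have er : TV.radLW kitOf wT j 1 (TV.nodeVW kitOf wT j s) = (TV.ctxOfW kitOf wT j).hullRad (TV.nodeVW kitOf wT j s) := rfl
  rw [er] at h1 h2
  unfold loOf hiOf
  show vre (TV.xD j s) c - vre (addVecUp TV.base.n TV.prec ((TV.ctxOfW kitOf wT j).hullRad (TV.nodeVW kitOf wT j s)) (wT j)) c ≤
      TV.base.wv (y + d) c ∧
    TV.base.wv (y + d) c ≤
      vre (TV.xD j s) c + vre (addVecUp TV.base.n TV.prec ((TV.ctxOfW kitOf wT j).hullRad (TV.nodeVW kitOf wT j s)) (wT j)) c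
  rw [ewv]
  constructor <;> linarith [h3.1, h3.2, hadd, h1, h2]

/-- **The a-block (node clauses of `ChainVCore`) for the interpreted records.** [folklore] -/
theorem aBlock_of_checks (hC : ChecksOK TV kitOf wT) (hK : CoreChecksOK TV wT) {j : ℕ} (hj : j ≤ TV.base.N₀)
    {s' : ℕ} (hs : s' ≤ TV.S j) :
    let cd := TV.toCertDataVW kitOf wT sc
    let bx := TV.toBoxesW kitOf wT
    cd.Wsupp (cd.x j s') ∧ (∀ n, cd.Wsupp (cd.P j s' n)) ∧
      IsLinearMap ℝ (cd.Cm j s') ∧ IsLinearMap ℝ (cd.Ci j s') ∧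
      (∀ v, cd.Wsupp (cd.Cm j s' v) ∧ cd.Wsupp (cd.Ci j s' v) ∧
        (cd.Wsupp v → cd.Ci j s' (cd.Cm j s' v) = v ∧ cd.Cm j s' (cd.Ci j s' v) = v)) ∧
      cd.P j s' 0 = cd.x j s' ∧
      (∀ n, n < cd.pdeg → ∀ i k, ((n : ℝ) + 1) * cd.P j s' (n + 1) i k =
        ∑ m' ∈ Finset.range (n + 1), cd.Qb (cd.P j s' m') (cd.P j s' (n - m')) i k) ∧
      (∀ v i k, cd.Wv j s' 0 v i k = if -cd.Kb ≤ k ∧ k ≤ cd.Ka then v i k else 0) ∧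
      (∀ n, n < bx.pdegV → ∀ v i k, ((n : ℝ) + 1) * cd.Wv j s' (n + 1) v i k =
        ∑ m' ∈ Finset.range (n + 1),
          (cd.Qb (cd.P j s' m') (cd.Wv j s' (n - m') v) i k + cd.Qb (cd.Wv j s' (n - m') v) (cd.P j s' m') i k)) ∧
      (∀ n, bx.pdegV < n → ∀ v, cd.Wv j s' n v = 0) ∧
      (∀ l : Fin 3, ∀ i k, 0 ≤ bx.rPl l j s' i k) ∧
      (∀ i k, bx.rPl 0 j s' i k ≤ bx.rPl 1 j s' i k ∧ bx.rPl 1 j s' i k ≤ bx.rPl 2 j s' i k) ∧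
      (∀ l : Fin 3, ∀ z, NodeStart cd bx j s' l z → InBox cd (bx.hlo l j s') (bx.hhi l j s') z) ∧
      (∀ l : Fin 3, ∀ i k, bx.hlo 2 j s' i k ≤ bx.hlo l j s' i k ∧ bx.hhi l j s' i k ≤ bx.hhi 2 j s' i k) := by
  intro cd bx
  have hKb : cd.Kb = TV.base.Kb := rfl
  have hKa : cd.Ka = TV.base.Ka := rfl
  have hQ : cd.Qb = (TV.base.toCertData QS2.toRealHom).Qb := rfl
  have hN := nodeOK_nodeV hC hj hs
  have hx : cd.Wsupp (cd.x j s') := fun i k hk => TV.xR_off j s' i hk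
  refine ⟨hx, fun n => ?_, TV.base.isLinearMap_linF _, TV.base.isLinearMap_linF _, fun v => ⟨fun i k hk =>
      TV.base.linF_off _ v i hk, fun i k hk => TV.base.linF_off _ v i hk, fun hv => ⟨?_, ?_⟩⟩, rfl, fun n _ i k => ?_,
    fun v i k => ?_, fun n hn v i k => ?_, fun n hn v => ?_, fun l i k => ?_, fun i k => ⟨le_rfl, le_rfl⟩,
    fun l z hz => inBox_of_nodeStart hC hK hj hs l hz, fun l i k => hull_nesting hC hK hj hs l i k⟩
  · -- jets are window-supported
    show (TV.base.toCertData QS2.toRealHom).Wsupp (taylorJet (TV.base.toCertData QS2.toRealHom).Qb (TV.xR j s') n)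
    exact wsupp_taylorJet _ hx n
  · exact linF_invMat_linF TV.prec TV.base hN hv
  · exact linF_linF_invMat TV.prec TV.base hN hv
  · -- jet recursion (every `n`)
    have h := congrFun (congrFun (taylorJet_succ (TV.base.toCertData QS2.toRealHom).Qb (TV.xR j s') n) i) k
    simp only [Pi.smul_apply, Finset.sum_apply, smul_eq_mul] at h
    exact h
  · -- `Wv 0 = trunc`
    show (if (0 : ℕ) ≤ TV.pdegV then varJet (TV.base.toCertData QS2.toRealHom).Qb (TV.xR j s')
        (trunc (TV.base.toCertData QS2.toRealHom) v) 0 else 0) i k = _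
    rw [if_pos (Nat.zero_le _), varJet_zero]
    rfl
  · -- variational recursion below `pdegV`
    have hn' : n < TV.pdegV := hn
    have eS : cd.Wv j s' (n + 1) v = varJet (TV.base.toCertData QS2.toRealHom).Qb (TV.xR j s')
        (trunc (TV.base.toCertData QS2.toRealHom) v) (n + 1) := by
      show (if n + 1 ≤ TV.pdegV then _ else 0) = _
      rw [if_pos (Nat.succ_le_of_lt hn')]
    have eM : ∀ m' ∈ Finset.range (n + 1), cd.Wv j s' (n - m') v = varJet (TV.base.toCertData QS2.toRealHom).Qb (TV.xR j s')
        (trunc (TV.base.toCertData QS2.toRealHom) v) (n - m') := fun m' _ => by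
      show (if n - m' ≤ TV.pdegV then _ else 0) = _
      rw [if_pos (by omega)]
    rw [eS, Finset.sum_congr rfl fun m' hm' => by rw [eM m' hm']]
    have h := congrFun (congrFun (varJet_succ (TV.base.toCertData QS2.toRealHom).Qb (TV.xR j s')
      (trunc (TV.base.toCertData QS2.toRealHom) v) n) i) k
    simp only [Pi.smul_apply, Finset.sum_apply, Pi.add_apply, smul_eq_mul] at h
    exact h
  · -- `Wv = 0` above `pdegV`
    have hn' : TV.pdegV < n := hn
    show (if n ≤ TV.pdegV then _ else (0 : Fin 4 → ℤ → ℝ)) = 0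
    rw [if_neg (by omega)]
  · -- `rPl ≥ 0`
    show 0 ≤ TV.base.vecF (vre (TV.nodeVW kitOf wT j s').rp) i k
    rw [TV.base.vecF_apply]
    split_ifs with hk
    · exact rp_nonneg hC hj hs (TV.base.idx_lt_n i hk)
    · exact le_rfl

/-- Stage and sub-step bookkeeping: `1 ≤ S`, `Tn 0 = 0`, `0 < h`, `Tn (s+1) = Tn s + h`. [folklore] -/
theorem bookkeeping_of_checks (hK : CoreChecksOK TV wT) {j : ℕ} (hj : j ≤ TV.base.N₀) :
    let cd := TV.toCertDataVW kitOf wT sc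
    1 ≤ cd.S j ∧ cd.Tn j 0 = 0 ∧ ∀ s', s' < cd.S j → 0 < cd.h j s' ∧ cd.Tn j (s' + 1) = cd.Tn j s' + cd.h j s' := by
  intro cd
  refine ⟨hK.S_pos j hj, TV.TnR_zero j, fun s' hs => ⟨?_, TV.TnR_succ j s'⟩⟩
  have h := (Dyad.blt_iff _ _).1 (hK.h_pos j hj s' hs)
  rw [Dyad.toReal_zero] at h
  show 0 < (TV.hD j s').toReal
  exact h

end Node

end CertTablesV

end Summit.NavierStokesRegularity.NavierStokesRegularity.Theorems.TaylorModelCert
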